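import Mathlib
import HarnessLib
import Summits.NavierStokesRegularity.NavierStokesRegularity.Theorems.TaylorModelRungThreeCertificateCoreStep
import Summits.NavierStokesRegularity.NavierStokesRegularity.Theorems.TaylorModelRungThreeCertificateFormatVBridge

/-!
# Crux K1b-DR (stmt-NavierStokesRegularity-23954), line `taylor-model` — the sub-step core, part 2: NAMED intermediate objects of
# `coreStep` (proof-side mirrors of its `let`s), the projection equations, the window predicates and the coordinate bridges

`coreStep` is one `let`-chain (each object computed once at run time). For the soundness proofs this file names every intermediate
object as a definition on `CoreIn` (`ci.QBA T`, `ci.P T`, `ci.B T`, `ci.hK T`, `ci.BK T`, `ci.TB T`, `ci.TB2 T`, `ci.Jarr T`, `ci.G T`, `ci.G' T`,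
`ci.UV T`, `ci.JUarr T`, `ci.S T`, `ci.Mmat T`, …), proves the PROJECTION EQUATIONS `(T.coreStep ci).ok / .lo / … = …` by `rfl`, introduces the
window predicates `T.InBoxW lo hi y` (= `TaylorModelV.InBox cd` whenever `cd.Kb = T.Kb`, `cd.Ka = T.Ka`: `inBoxW_iff`) and `T.InBallW`, and the
coordinate bridges between the dyadic output arrays read through engine-1's `T.vecF (vre ·)` and the interval objects.

MODEL-lattice bookkeeping only (rung TL-M3); nothing here concerns the Navier–Stokes equations.
-/

-- the sub-problem namespace repeats the summit name by design (D-0017)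
set_option linter.dupNamespace false

namespace Summit.NavierStokesRegularity.NavierStokesRegularity.Theorems.TaylorModelCert

open scoped BigOperators
open Literature.Analysis.FluidPDE.TaoCascade Literature.Analysis.FluidPDE.TaoCascade.TaylorChain
open Summit.NavierStokesRegularity.NavierStokesRegularity.Theorems.TaylorModelV (InBox)

namespace CoreIn

variable {K : Type} (T : CertTables K) (ci : CoreIn)

/-- The sparse field twin of the attempt. [folklore] -/
def QBA : Array IntervalD → Array IntervalD → Array IntervalD := T.qBboxMA ci.coefB ci.prec ci.mt
/-- The in-step time box `[0, h]`. [folklore] -/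
def Uh : IntervalD := ⟨Dyad.ofInt 0, ci.h⟩
/-- Jets of the hull box to order `p`. [folklore] -/
def LsH : Array (Array IntervalD) := IntervalD.jetLevelsA T.n (ci.QBA T) ci.prec ci.H2 ci.p
/-- Range of the Taylor polynomial over `u ∈ [0,h]`. [folklore] -/
def P : Array IntervalD := IntervalD.polyLevelsA T.n ci.prec (ci.LsH T) ci.p ci.Uh
/-- The state box `B` (chosen). [folklore] -/
def B : Array IntervalD := Array.ofFn fun c : Fin T.n => IntervalD.inflate ci.prec ci.infl (IntervalD.aget (ci.P T) c)
/-- The reduced row factor `L1′`. [folklore] -/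
def L1q : Dyad := Dyad.sub ci.L1 (Dyad.shift ci.L1 (-12))
/-- Radii of the κ-difference box. [folklore] -/
def hK : Array Dyad := Array.ofFn fun c : Fin T.n => Dyad.roundUp ci.prec (Dyad.mul ci.L1q (IntervalD.aget ci.κωB c).hi)
/-- Radii of the variation box. [folklore] -/
def hV : Array Dyad := Array.ofFn fun c : Fin T.n => Dyad.roundUp ci.prec (Dyad.mul ci.L1q (IntervalD.aget ci.ωB c).hi)
/-- The κ-difference box `BK`. [folklore] -/
def BK : Array IntervalD := Array.ofFn fun c : Fin T.n => IntervalD.symBox (dget (ci.hK T) c)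
/-- The variation box `BV`. [folklore] -/
def BV : Array IntervalD := Array.ofFn fun c : Fin T.n => IntervalD.symBox (dget (ci.hV T) c)
/-- The tube box `B ⊕ BK`. [folklore] -/
def TB : Array IntervalD := Array.ofFn fun c : Fin T.n => IntervalD.add (IntervalD.aget (ci.B T) c) (IntervalD.aget (ci.BK T) c)
/-- The doubled tube box `B ⊕ 2BK`. [folklore] -/
def TB2 : Array IntervalD := Array.ofFn fun c : Fin T.n => IntervalD.add (IntervalD.aget (ci.TB T) c) (IntervalD.aget (ci.BK T) c)
/-- Jets of the tube box to order `p+1`. [folklore] -/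
def LsT : Array (Array IntervalD) := IntervalD.jetLevelsA T.n (ci.QBA T) ci.prec (ci.TB T) (ci.p + 1)
/-- `J` = magnitudes of the top tube jets. [folklore] -/
def Jarr : Array Dyad := Array.ofFn fun c : Fin T.n => IntervalD.mag (IntervalD.aget (IntervalD.lget (ci.LsT T) (ci.p + 1)) c)
/-- `[0, h]^(p+1)`. [folklore] -/
def Hp : IntervalD := IntervalD.powR ci.prec ci.Uh (ci.p + 1)
/-- `G ∋ Qb y d + Qb d y + Qb d d` over tube × BK. [folklore] -/
def G : Array IntervalD := Array.ofFn fun c : Fin T.n =>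
  IntervalD.addR ci.prec (IntervalD.aget (IntervalD.applyLinF T.n ci.prec (T.linSym ci.coefB ci.prec ci.mt (ci.TB T)) (ci.BK T)) c)
    (IntervalD.aget ((ci.QBA T) (ci.BK T) (ci.BK T)) c)
/-- `G′ ∋ Qb y v + Qb v y` over doubled tube × BV. [folklore] -/
def G' : Array IntervalD := IntervalD.applyLinF T.n ci.prec (T.linSym ci.coefB ci.prec ci.mt (ci.TB2 T)) (ci.BV T)
/-- Jets of the doubled tube to order `pV+1`. [folklore] -/
def LsT2 : Array (Array IntervalD) := IntervalD.jetLevelsA T.n (ci.QBA T) ci.prec (ci.TB2 T) (ci.pV + 1)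
/-- Vector variational levels over doubled tube × BV. [folklore] -/
def UV : Array (Array IntervalD) :=
  IntervalD.wColLevelsF T.n ci.prec (IntervalD.opsOf (T.linSym ci.coefB ci.prec ci.mt) (ci.LsT2 T) (ci.pV + 1)) (ci.BV T) (ci.pV + 1)
/-- `JU` = magnitudes of the top variational level. [folklore] -/
def JUarr : Array Dyad := Array.ofFn fun c : Fin T.n => IntervalD.mag (IntervalD.aget (IntervalD.lget (ci.UV T) (ci.pV + 1)) c)
/-- `[h, h]^(pV+1)`. [folklore] -/
def hp1 : IntervalD := IntervalD.powR ci.prec (IntervalD.ofDyad ci.h) (ci.pV + 1)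
/-- Row remainder scales `JU_r · h^(pV+1)`. [folklore] -/
def S : Array IntervalD := Array.ofFn fun c : Fin T.n => IntervalD.mulR ci.prec (IntervalD.ofDyad (dget (ci.JUarr T) c)) ci.hp1
/-- The signed derivative matrix. [folklore] -/
def Mmat : Array (Array IntervalD) := T.stepMatrixMF ci.coefB ci.prec ci.H2 ci.pV (IntervalD.ofDyad ci.h) (ci.S T) ci.ωinvB

/-! #### Projection equations (by `rfl`) -/

/-- [folklore] -/
theorem coreStep_ok : (T.coreStep ci).ok = (IntervalD.testE2 T.n ci.prec (ci.B T) (ci.P T) (ci.Jarr T) ci.Hp &&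
    IntervalD.testK T.n ci.prec ci.L1 ci.h ci.κωB (ci.hK T) (ci.G T) && IntervalD.testK T.n ci.prec ci.L1 ci.h ci.ωB (ci.hV T) (ci.G' T)) := rfl
/-- [folklore] -/
theorem coreStep_lo : (T.coreStep ci).lo = Array.ofFn fun c : Fin T.n => (IntervalD.aget (ci.B T) c).lo := rfl
/-- [folklore] -/
theorem coreStep_hi : (T.coreStep ci).hi = Array.ofFn fun c : Fin T.n => (IntervalD.aget (ci.B T) c).hi := rfl
/-- [folklore] -/
theorem coreStep_loK : (T.coreStep ci).loK = Array.ofFn fun c : Fin T.n => Dyad.neg (dget (ci.hK T) c) := rfl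
/-- [folklore] -/
theorem coreStep_hiK : (T.coreStep ci).hiK = ci.hK T := rfl
/-- [folklore] -/
theorem coreStep_loV : (T.coreStep ci).loV = Array.ofFn fun c : Fin T.n => Dyad.neg (dget (ci.hV T) c) := rfl
/-- [folklore] -/
theorem coreStep_hiV : (T.coreStep ci).hiV = ci.hV T := rfl
/-- [folklore] -/
theorem coreStep_J : (T.coreStep ci).J = ci.Jarr T := rfl
/-- [folklore] -/
theorem coreStep_JU : (T.coreStep ci).JU = ci.JUarr T := rfl
/-- [folklore] -/
theorem coreStep_M : (T.coreStep ci).M = ci.Mmat T := rfl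
/-- [folklore] -/
theorem coreStep_L1 : (T.coreStep ci).L1 = ci.L1 := rfl

/-! #### Sizes -/

/-- [folklore] -/
theorem size_B : (ci.B T).size = T.n := by simp only [B, Array.size_ofFn]
/-- [folklore] -/
theorem size_BK : (ci.BK T).size = T.n := by simp only [BK, Array.size_ofFn]
/-- [folklore] -/
theorem size_BV : (ci.BV T).size = T.n := by simp only [BV, Array.size_ofFn]
/-- [folklore] -/
theorem size_TB : (ci.TB T).size = T.n := by simp only [TB, Array.size_ofFn]
/-- [folklore] -/
theorem size_TB2 : (ci.TB2 T).size = T.n := by simp only [TB2, Array.size_ofFn]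

end CoreIn

namespace CertTables

variable {K : Type} (T : CertTables K)

/-- Window box on shell states, in the TABLES' window (`= TaylorModelV.InBox cd` when `cd.Kb = T.Kb`, `cd.Ka = T.Ka`). [folklore] -/
def InBoxW (lo hi y : Fin 4 → ℤ → ℝ) : Prop := ∀ i k, -T.Kb ≤ k → k ≤ T.Ka → lo i k ≤ y i k ∧ y i k ≤ hi i k

/-- Weighted ball on the window: `|y i k| ≤ N · ω k` (`= cd.InBall j y N` with `ω = cd.ω j` under the same window). [folklore] -/
def InBallW (ω : ℤ → ℝ) (y : Fin 4 → ℤ → ℝ) (N : ℝ) : Prop := ∀ i k, -T.Kb ≤ k → k ≤ T.Ka → |y i k| ≤ N * ω k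

/-- `InBox cd ↔ InBoxW` under the window equalities. [folklore] -/
theorem inBoxW_iff {cd : CertData} (hKb : cd.Kb = T.Kb) (hKa : cd.Ka = T.Ka) (lo hi y : Fin 4 → ℤ → ℝ) :
    InBox cd lo hi y ↔ T.InBoxW lo hi y := by
  simp only [InBox, InBoxW, hKb, hKa]

/-- `cd.InBall j ↔ InBallW (cd.ω j)` under the window equalities. [folklore] -/
theorem inBallW_iff {cd : CertData} (hKb : cd.Kb = T.Kb) (hKa : cd.Ka = T.Ka) (j : ℕ) (y : Fin 4 → ℤ → ℝ) (N : ℝ) :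
    cd.InBall j y N ↔ T.InBallW (cd.ω j) y N := by
  simp only [CertData.InBall, InBallW, hKb, hKa]

/-- Coordinates of a state in a window box of dyadic-array ends lie in the corresponding intervals. [folklore] -/
theorem mem_of_inBoxW_vecF {lo hi : Array Dyad} {X : Array IntervalD} {y : Fin 4 → ℤ → ℝ}
    (hX : ∀ c < T.n, (IntervalD.aget X c).lo = dget lo c ∧ (IntervalD.aget X c).hi = dget hi c)
    (hy : T.InBoxW (T.vecF (vre lo)) (T.vecF (vre hi)) y) : ∀ c < T.n, IntervalD.mem (T.wv y c) (IntervalD.aget X c) := by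
  intro c hc
  have hk := T.InW_wk hc
  have h := hy (T.wi c) (T.wk c) hk.1 hk.2
  rw [T.vecF_apply, T.vecF_apply, if_pos hk, if_pos hk, T.idx_wi_wk hc] at h
  unfold wv
  exact ⟨by rw [(hX c hc).1]; exact h.1, by rw [(hX c hc).2]; exact h.2⟩

/-- Coordinates of a state in the window box of the ENDS of an interval array lie in its intervals. [folklore] -/
theorem mem_of_inBoxW_loR {X : Array IntervalD} {y : Fin 4 → ℤ → ℝ}
    (hy : T.InBoxW (T.vecF (IntervalD.loR X)) (T.vecF (IntervalD.hiR X)) y) : ∀ c < T.n, IntervalD.mem (T.wv y c) (IntervalD.aget X c) := by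
  intro c hc
  have hk := T.InW_wk hc
  have h := hy (T.wi c) (T.wk c) hk.1 hk.2
  rw [T.vecF_apply, T.vecF_apply, if_pos hk, if_pos hk, T.idx_wi_wk hc] at h
  exact h

end CertTables

end Summit.NavierStokesRegularity.NavierStokesRegularity.Theorems.TaylorModelCert
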